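import Summits.Langlands.Langlands.Theorems.BrightMateBypass

/-!
# BrightMateBypass — part 2 (§6 FRAME certificate and the deciding theorem `closes`, §7 necessity certificates, §3b child-route one-liners (Iff.rfl), §8 offer `liftw_iff_lone`)

Tail (lines 391–552 verbatim) of the decomp-langlands lens-5 g10 node v3 `HOME/nodes/lens-5-g10-BrightMateBypass.lean` (sha256 259ced12e22b…),
split off by census-1 g17 to respect the 400-line cap; part 1 = `Theorems/BrightMateBypass.lean` (§1–§5b: vocabulary, dial, cells, lemmas, kernel `rno3_iff_lone`).
-/

set_option linter.dupNamespace false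

namespace Summit.Langlands.Langlands.Theorems.BrightMate

open Filter Polynomial IsDedekindDomain NumberField
open Literature.NumberTheory.GaloisRepresentations
open Literature.NumberTheory.Automorphic
open Literature.NumberTheory.PAdicHodge
open Literature.NumberTheory.LFunctions
open Summit.Langlands.Langlands.Theses

/-! ## §6 FRAME certificate and the child route's deciding theorem -/

/-- The host's resplit glue (stmt-Langlands-33911, CLOSED p777101) re-proved inline: A† → F† → RPO → RNO₂ → RNO₃ → Lift_w. -/
theorem liftw_of_five (hA : OdlyzkoWorldSplit.IrreducibleLargePrimeLifting) (hF : OdlyzkoWorldSplit.IrreducibleSmallPrimeLifting)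
    (hPO : OdlyzkoWorldSplit.CyclotomicReducibleOrdinaryLifting) (h2 : OdlyzkoWorldSplit.CyclotomicReducibleNonOrdinaryRankTwoLifting)
    (h3 : OdlyzkoWorldSplit.CyclotomicReducibleNonOrdinaryHigherRankLifting) : OdlyzkoWorldSplit.AutomorphyLifting := by
  suffices key : ∀ n, LiftAt n from fun K _ _ n hcpt hn ℓ _ ι ρ => key n K hcpt hn ℓ ι ρ
  intro n
  induction n using Nat.strong_induction_on with
  | _ n ihn =>
    intro K _ _ hcpt hn ℓ _ ι ρ
    have ih : LiftBelow n := fun m hm => ihn m hm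
    by_cases hc : CycIrr ρ
    · rcases Nat.lt_or_ge ℓ (2 * (n + 1)) with hlt | hge
      · exact hF K n hcpt hn ih ℓ ι ρ hlt hc
      · exact hA K n hcpt hn ih ℓ ι ρ hge hc
    · by_cases hpo : PotOrd ρ
      · exact hPO K n hcpt hn ih ℓ ι ρ hc hpo
      · rcases Nat.lt_or_ge n 3 with hlt | hge
        · exact h2 K n hcpt hn (Nat.le_of_lt_succ hlt) ih ℓ ι ρ hc hpo
        · exact h3 K n hcpt hn hge ih ℓ ι ρ hc hpo

/-- FRAME is the host complement: the host's other TEN items give `RNO₃ → Langlands` (host `closes` + the resplit glue). -/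
theorem frame_of_host (hA : OdlyzkoWorldSplit.IrreducibleLargePrimeLifting) (hF : OdlyzkoWorldSplit.IrreducibleSmallPrimeLifting)
    (hPO : OdlyzkoWorldSplit.CyclotomicReducibleOrdinaryLifting) (h2 : OdlyzkoWorldSplit.CyclotomicReducibleNonOrdinaryRankTwoLifting)
    (hOW : OdlyzkoWorldSplit.OdlyzkoWorldAutomorphy) (hRES : OdlyzkoWorldSplit.TransOdlyzkoAutomorphy)
    (hW : OdlyzkoWorldSplit.SatakeAvatarExistence) (hP : OdlyzkoWorldSplit.PadicMemberCompatibility)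
    (hLR : OdlyzkoWorldSplit.CompatibilityAwayFromLR) (hCRD : OdlyzkoWorldSplit.CanonicalReciprocityData) :
    HigherRankDarkLiftingFrame :=
  fun h3 => OdlyzkoWorldSplit.closes hOW hRES (liftw_of_five hA hF hPO h2 h3) hW hP hLR hCRD

/-- **Deciding theorem of the child route** (shape of `glue.lean`): LONE → BRIGHT → A† → OW → RES → W⁺ → AUT↑ → CSD → FRAME → Langlands. -/
theorem closes (hL : LoneDarkHigherRankLifting) (hB : DensityOneCyclotomicBrightness)
    (hA : OdlyzkoWorldSplit.IrreducibleLargePrimeLifting)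
    (hOW : OdlyzkoWorldSplit.OdlyzkoWorldAutomorphy) (hRES : OdlyzkoWorldSplit.TransOdlyzkoAutomorphy)
    (hW : OdlyzkoWorldSplit.SatakeAvatarExistence) (hUp : SolvableAscentConstituent)
    (hCSD : HolomorphicLimitSplit.CliffordSolvableDescent) (hFr : HigherRankDarkLiftingFrame) : _root_.Langlands :=
  hFr (rno3_of_lone hL hB hOW hRES hW hA hUp hCSD)

/-- The same with the host complement spelled out (the TEN other host items + LONE + BRIGHT + AUT↑ + CSD ⟹ Langlands). -/
theorem closes_host (hL : LoneDarkHigherRankLifting) (hB : DensityOneCyclotomicBrightness)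
    (hA : OdlyzkoWorldSplit.IrreducibleLargePrimeLifting) (hF : OdlyzkoWorldSplit.IrreducibleSmallPrimeLifting)
    (hPO : OdlyzkoWorldSplit.CyclotomicReducibleOrdinaryLifting) (h2 : OdlyzkoWorldSplit.CyclotomicReducibleNonOrdinaryRankTwoLifting)
    (hOW : OdlyzkoWorldSplit.OdlyzkoWorldAutomorphy) (hRES : OdlyzkoWorldSplit.TransOdlyzkoAutomorphy)
    (hW : OdlyzkoWorldSplit.SatakeAvatarExistence) (hP : OdlyzkoWorldSplit.PadicMemberCompatibility)
    (hLR : OdlyzkoWorldSplit.CompatibilityAwayFromLR) (hCRD : OdlyzkoWorldSplit.CanonicalReciprocityData)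
    (hUp : SolvableAscentConstituent) (hCSD : HolomorphicLimitSplit.CliffordSolvableDescent) : _root_.Langlands :=
  OdlyzkoWorldSplit.closes hOW hRES (liftw_of_five hA hF hPO h2 (rno3_of_lone hL hB hOW hRES hW hA hUp hCSD)) hW hP hLR hCRD

/-! ## §7 Certificates (necessity: S ⟹ every new item that is not print) -/

namespace Cert

/-- S ⟹ Lift_w (direction (B) of `Langlands` at the reciprocity datum of its non-vacuity conjunct; g9 verbatim). -/
theorem liftw_of_langlands (hS : _root_.Langlands) : OdlyzkoWorldSplit.AutomorphyLifting := by
  intro K _ _ n hcpt hn ℓ _ ι ρ hirr hgeo _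
  obtain ⟨⟨𝓡⟩, h𝓡⟩ := hS K
  obtain ⟨π, hL, hcorr⟩ := (h𝓡 𝓡 n hn hcpt).2 ℓ ι ρ hirr hgeo
  exact ⟨π, hL, hcorr.1⟩

/-- S ⟹ RNO₃ (sub-box of Lift_w). -/
theorem rno3_of_langlands (hS : _root_.Langlands) : OdlyzkoWorldSplit.CyclotomicReducibleNonOrdinaryHigherRankLifting :=
  fun K _ _ n hcpt hn _ _ ℓ _ ι ρ _ _ => liftw_of_langlands hS K n hcpt hn ℓ ι ρ

/-- S ⟹ LONE (necessity of the residual: it is WEAKER than S). -/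
theorem lone_of_langlands (hS : _root_.Langlands) : LoneDarkHigherRankLifting := lone_of_rno3 (rno3_of_langlands hS)

/-- S ⟹ FRAME (trivially: FRAME concludes S). -/
theorem frame_of_langlands (hS : _root_.Langlands) : HigherRankDarkLiftingFrame := fun _ => hS

end Cert

/-! ## §3b The child-route ONE-LINERS (what the gate will render under `Theses/BrightMateBypass.lean`), certified IDENTICAL to the structured cells -/

/-- childroute.route.json `LoneDarkHigherRankLifting` verbatim (10150 chars). -/
def LoneDarkHigherRankLiftingInline : Prop :=
  ∀ (K : Type) [Field K] [NumberField K] (n : ℕ) (hcpt : Literature.NumberTheory.Automorphic.isCompact_glFiniteIntegralLevel n K), 0 < n → 3 ≤ n → (∀ m : ℕ, m < n → ∀ (K : Type) [Field K] [NumberField K] (hcpt : Literature.NumberTheory.Automorphic.isCompact_glFiniteIntegralLevel m K), 0 < m → ∀ (ℓ : ℕ) [Fact ℓ.Prime] (ι : PadicAlgCl ℓ ≃+* ℂ) (ρ : Literature.NumberTheory.GaloisRepresentations.FramedGaloisRep K (PadicAlgCl ℓ) m), ρ.toGaloisRep.IsIrreducible → ((∀ᶠ v : IsDedekindDomain.HeightOneSpectrum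 (NumberField.RingOfIntegers K) in cofinite, ρ.IsUnramifiedAt v) ∧ ∀ (v : IsDedekindDomain.HeightOneSpectrum (NumberField.RingOfIntegers K)) (hv : ((ℓ : ℕ) : NumberField.RingOfIntegers K) ∈ v.asIdeal), (Literature.NumberTheory.PAdicHodge.fontainePstAdicCompletion v ℓ hv).IsDeRhamFramed (ρ.toLocal v)) → (∃ (π : Literature.NumberTheory.Automorphic.CuspidalAutomorphicRepData m K hcpt) (ρ' : Literature.NumberTheory.GaloisRepresentations.FramedGaloisRep K (PadicAlgCl ℓ) m), π.1.IsLAlgebraic ∧ ρ'.toGaloisRep.IsIrreducible ∧ (∀ᶠ v : IsDedekindDomain.HeightOneSpectrum (NumberField.RingOfIntegers K) in cofinite, SatakeFrobCompatibleAt ι π.1 ρ' v) ∧ ∀ᶠ v : IsDedekindDomain.HeightOneSpectrum (NumberField.RingOfIntegers K) in cofinite, ∃ P P' : Polynomial (Valued.v : Valuation (PadicAlgCl ℓ) NNReal).valuationSubring, ρ.HasFrobCharpolyAt v (P.map (Valued.v : Valuation (PadicAlgCl ℓ) NNReal).valuationSubring.subtype) ∧ ρ'.HasFrobCharpolyAt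 v (P'.map (Valued.v : Valuation (PadicAlgCl ℓ) NNReal).valuationSubring.subtype) ∧ P.map (IsLocalRing.residue (Valued.v : Valuation (PadicAlgCl ℓ) NNReal).valuationSubring) = P'.map (IsLocalRing.residue (Valued.v : Valuation (PadicAlgCl ℓ) NNReal).valuationSubring)) → ∃ π : Literature.NumberTheory.Automorphic.CuspidalAutomorphicRepData m K hcpt, π.1.IsLAlgebraic ∧ ∀ᶠ v : IsDedekindDomain.HeightOneSpectrum (NumberField.RingOfIntegers K) in cofinite, SatakeFrobCompatibleAt ι π.1 ρ v) → ∀ (ℓ : ℕ) [Fact ℓ.Prime] (ι : PadicAlgCl ℓ ≃+* ℂ) (ρ : Literature.NumberTheory.GaloisRepresentations.FramedGaloisRep K (PadicAlgCl ℓ) n), ¬ (ρ.restrictField (CyclotomicField ℓ K)).IsResiduallyAbsIrreducible → ¬ (∃ (L : Type) (_ : Field L) (_ : NumberField L) (_ : Algebra K L), IsGalois K L ∧ IsSolvable (L ≃ₐ[K] L) ∧ ∀ (w : IsDedekindDomain.HeightOneSpectrum (NumberField.RingOfIntegers L)) (hw : ((ℓ : ℕ) : NumberField.RingOfIntegers L)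 ∈ w.asIdeal), letI := (Literature.NumberTheory.PAdicHodge.fontainePstAdicCompletion w ℓ hw).algebra; ∃ (g : GL (Fin n) (PadicAlgCl ℓ)) (ψ : Fin n → Literature.NumberTheory.GaloisRepresentations.FramedGaloisRep (w.adicCompletion L) (PadicAlgCl ℓ) 1) (a : Fin n → ((w.adicCompletion L) →ₐ[ℚ_[ℓ]] PadicAlgCl ℓ) → ℤ), Literature.NumberTheory.GaloisRepresentations.FramedRep.IsUpperTriangular (((ρ.restrictField L).toLocal w).conj g) ∧ (∀ (σ : Field.absoluteGaloisGroup (w.adicCompletion L)) (i : Fin n), Literature.NumberTheory.GaloisRepresentations.FramedRep.diagEntry (((ρ.restrictField L).toLocal w).conj g) i σ = (ψ i).trace σ) ∧ (∀ i : Fin n, (Literature.NumberTheory.PAdicHodge.fontainePstAdicCompletion w ℓ hw).IsDeRhamFramed (ψ i)) ∧ (∀ (i : Fin n) (τ : (w.adicCompletion L) →ₐ[ℚ_[ℓ]] PadicAlgCl ℓ), (Literature.NumberTheory.PAdicHodge.fontainePstAdicCompletion w ℓ hw).𝔅.labelledHodgeTateWeights (ψ i).toGaloisRep τ.toRingHom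 = {a i τ}) ∧ (∀ τ : (w.adicCompletion L) →ₐ[ℚ_[ℓ]] PadicAlgCl ℓ, StrictMono (fun i : Fin n => a i τ))) → ¬ (∃ (E : Type) (_ : Field E) (_ : NumberField E) (_ : Algebra K E), IsGalois K E ∧ IsSolvable (E ≃ₐ[K] E) ∧ ∃ (m : ℕ) (ϑ : Literature.NumberTheory.GaloisRepresentations.FramedGaloisRep E (PadicAlgCl ℓ) m), m < n ∧ 0 < m ∧ ϑ.toGaloisRep.IsIrreducible ∧ ((∀ᶠ v : IsDedekindDomain.HeightOneSpectrum (NumberField.RingOfIntegers E) in cofinite, ϑ.IsUnramifiedAt v) ∧ ∀ (v : IsDedekindDomain.HeightOneSpectrum (NumberField.RingOfIntegers E)) (hv : ((ℓ : ℕ) : NumberField.RingOfIntegers E) ∈ v.asIdeal), (Literature.NumberTheory.PAdicHodge.fontainePstAdicCompletion v ℓ hv).IsDeRhamFramed (ϑ.toLocal v)) ∧ (∃ (mc : ℕ) (θc : Literature.NumberTheory.GaloisRepresentations.FramedGaloisRep E (PadicAlgCl ℓ) mc), ∀ g : Field.absoluteGaloisGroup E, Literature.NumberTheory.GaloisRepresentations.FramedRep.trace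 (ρ.restrictField E) g = Literature.NumberTheory.GaloisRepresentations.FramedRep.trace ϑ g + Literature.NumberTheory.GaloisRepresentations.FramedRep.trace θc g)) → ¬ ((∃ (S : Finset (IsDedekindDomain.HeightOneSpectrum (NumberField.RingOfIntegers K))) (Q : IsDedekindDomain.HeightOneSpectrum (NumberField.RingOfIntegers K) → Polynomial ℂ) (I : Finset ℤ) (L : Set ℕ) (r : ∀ (ℓ' : ℕ) [Fact ℓ'.Prime], (PadicAlgCl ℓ' ≃+* ℂ) → Literature.NumberTheory.GaloisRepresentations.FramedGaloisRep K (PadicAlgCl ℓ') n), ((∃ E : Subfield ℂ, FiniteDimensional ℚ E ∧ ∀ v : IsDedekindDomain.HeightOneSpectrum (NumberField.RingOfIntegers K), v ∉ S → ∀ i : ℕ, (Q v).coeff i ∈ E) ∧ Literature.NumberTheory.LFunctions.HasDirichletDensity L 1 ∧ ∀ (ℓ' : ℕ) [Fact ℓ'.Prime], ℓ' ∈ L → ∀ ι' : PadicAlgCl ℓ' ≃+* ℂ, (r ℓ' ι').toGaloisRep.IsIrreducible ∧ (∀ᶠ v : IsDedekindDomain.HeightOneSpectrum (NumberField.RingOfIntegers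 K) in cofinite, (r ℓ' ι').IsUnramifiedAt v) ∧ (∀ v : IsDedekindDomain.HeightOneSpectrum (NumberField.RingOfIntegers K), v ∉ S → ((ℓ' : ℕ) : NumberField.RingOfIntegers K) ∉ v.asIdeal → (r ℓ' ι').IsUnramifiedAt v ∧ (r ℓ' ι').HasFrobCharpolyAt v ((Q v).map (ι'.symm : ℂ ≃+* PadicAlgCl ℓ').toRingHom)) ∧ ∀ (v : IsDedekindDomain.HeightOneSpectrum (NumberField.RingOfIntegers K)) (hv : ((ℓ' : ℕ) : NumberField.RingOfIntegers K) ∈ v.asIdeal), (Literature.NumberTheory.PAdicHodge.fontainePstAdicCompletion v ℓ' hv).IsDeRhamFramed ((r ℓ' ι').toLocal v) ∧ (v ∉ S → (Literature.NumberTheory.PAdicHodge.fontainePstAdicCompletion v ℓ' hv).IsCrystallineFramed ((r ℓ' ι').toLocal v) ∧ letI := (Literature.NumberTheory.PAdicHodge.fontainePstAdicCompletion v ℓ' hv).algebra; ∀ τ : v.adicCompletion K →ₐ[ℚ_[ℓ']] PadicAlgCl ℓ', ∀ h ∈ (r ℓ' ι').labelledHodgeTateWeightsAt v (Literature.NumberTheory.PAdicHodge.fontainePstAdicCompletion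 v ℓ' hv).algebra (Literature.NumberTheory.PAdicHodge.fontainePstAdicCompletion v ℓ' hv).𝔅 τ.toRingHom, h ∈ I)) ∧ ∀ v : IsDedekindDomain.HeightOneSpectrum (NumberField.RingOfIntegers K), v ∉ S → ((ℓ : ℕ) : NumberField.RingOfIntegers K) ∉ v.asIdeal → ρ.IsUnramifiedAt v ∧ ρ.HasFrobCharpolyAt v ((Q v).map (ι.symm : ℂ ≃+* PadicAlgCl ℓ).toRingHom)) ∨ ∃ (N : Type) (_ : Field N) (_ : NumberField N) (_ : Algebra K N) (M : Type) (_ : Field M) (_ : NumberField M) (_ : Algebra K M) (_ : Algebra M N) (_ : IsScalarTower K M N), IsGalois K N ∧ IsSolvable (N ≃ₐ[K] N) ∧ (ρ.restrictField M).toGaloisRep.IsIrreducible ∧ ∃ (S : Finset (IsDedekindDomain.HeightOneSpectrum (NumberField.RingOfIntegers M))) (Q : IsDedekindDomain.HeightOneSpectrum (NumberField.RingOfIntegers M) → Polynomial ℂ) (I : Finset ℤ) (L : Set ℕ) (r : ∀ (ℓ' : ℕ) [Fact ℓ'.Prime], (PadicAlgCl ℓ' ≃+* ℂ) → Literature.NumberTheory.GaloisRepresentations.FramedGaloisRep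 M (PadicAlgCl ℓ') n), ((∃ E : Subfield ℂ, FiniteDimensional ℚ E ∧ ∀ v : IsDedekindDomain.HeightOneSpectrum (NumberField.RingOfIntegers M), v ∉ S → ∀ i : ℕ, (Q v).coeff i ∈ E) ∧ Literature.NumberTheory.LFunctions.HasDirichletDensity L 1 ∧ ∀ (ℓ' : ℕ) [Fact ℓ'.Prime], ℓ' ∈ L → ∀ ι' : PadicAlgCl ℓ' ≃+* ℂ, (r ℓ' ι').toGaloisRep.IsIrreducible ∧ (∀ᶠ v : IsDedekindDomain.HeightOneSpectrum (NumberField.RingOfIntegers M) in cofinite, (r ℓ' ι').IsUnramifiedAt v) ∧ (∀ v : IsDedekindDomain.HeightOneSpectrum (NumberField.RingOfIntegers M), v ∉ S → ((ℓ' : ℕ) : NumberField.RingOfIntegers M) ∉ v.asIdeal → (r ℓ' ι').IsUnramifiedAt v ∧ (r ℓ' ι').HasFrobCharpolyAt v ((Q v).map (ι'.symm : ℂ ≃+* PadicAlgCl ℓ').toRingHom)) ∧ ∀ (v : IsDedekindDomain.HeightOneSpectrum (NumberField.RingOfIntegers M)) (hv : ((ℓ' : ℕ) : NumberField.RingOfIntegers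 M) ∈ v.asIdeal), (Literature.NumberTheory.PAdicHodge.fontainePstAdicCompletion v ℓ' hv).IsDeRhamFramed ((r ℓ' ι').toLocal v) ∧ (v ∉ S → (Literature.NumberTheory.PAdicHodge.fontainePstAdicCompletion v ℓ' hv).IsCrystallineFramed ((r ℓ' ι').toLocal v) ∧ letI := (Literature.NumberTheory.PAdicHodge.fontainePstAdicCompletion v ℓ' hv).algebra; ∀ τ : v.adicCompletion M →ₐ[ℚ_[ℓ']] PadicAlgCl ℓ', ∀ h ∈ (r ℓ' ι').labelledHodgeTateWeightsAt v (Literature.NumberTheory.PAdicHodge.fontainePstAdicCompletion v ℓ' hv).algebra (Literature.NumberTheory.PAdicHodge.fontainePstAdicCompletion v ℓ' hv).𝔅 τ.toRingHom, h ∈ I)) ∧ ∀ v : IsDedekindDomain.HeightOneSpectrum (NumberField.RingOfIntegers M), v ∉ S → ((ℓ : ℕ) : NumberField.RingOfIntegers M) ∉ v.asIdeal → (ρ.restrictField M).IsUnramifiedAt v ∧ (ρ.restrictField M).HasFrobCharpolyAt v ((Q v).map (ι.symm : ℂ ≃+* PadicAlgCl ℓ).toRingHom)) → ρ.toGaloisRep.IsIrreducible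 → ((∀ᶠ v : IsDedekindDomain.HeightOneSpectrum (NumberField.RingOfIntegers K) in cofinite, ρ.IsUnramifiedAt v) ∧ ∀ (v : IsDedekindDomain.HeightOneSpectrum (NumberField.RingOfIntegers K)) (hv : ((ℓ : ℕ) : NumberField.RingOfIntegers K) ∈ v.asIdeal), (Literature.NumberTheory.PAdicHodge.fontainePstAdicCompletion v ℓ hv).IsDeRhamFramed (ρ.toLocal v)) → (∃ (π : Literature.NumberTheory.Automorphic.CuspidalAutomorphicRepData n K hcpt) (ρ' : Literature.NumberTheory.GaloisRepresentations.FramedGaloisRep K (PadicAlgCl ℓ) n), π.1.IsLAlgebraic ∧ ρ'.toGaloisRep.IsIrreducible ∧ (∀ᶠ v : IsDedekindDomain.HeightOneSpectrum (NumberField.RingOfIntegers K) in cofinite, SatakeFrobCompatibleAt ι π.1 ρ' v) ∧ ∀ᶠ v : IsDedekindDomain.HeightOneSpectrum (NumberField.RingOfIntegers K) in cofinite, ∃ P P' : Polynomial (Valued.v : Valuation (PadicAlgCl ℓ) NNReal).valuationSubring, ρ.HasFrobCharpolyAt v (P.map (Valued.v : Valuation (PadicAlgCl ℓ) NNReal).valuationSubring.subtype)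 ∧ ρ'.HasFrobCharpolyAt v (P'.map (Valued.v : Valuation (PadicAlgCl ℓ) NNReal).valuationSubring.subtype) ∧ P.map (IsLocalRing.residue (Valued.v : Valuation (PadicAlgCl ℓ) NNReal).valuationSubring) = P'.map (IsLocalRing.residue (Valued.v : Valuation (PadicAlgCl ℓ) NNReal).valuationSubring)) → ∃ π : Literature.NumberTheory.Automorphic.CuspidalAutomorphicRepData n K hcpt, π.1.IsLAlgebraic ∧ ∀ᶠ v : IsDedekindDomain.HeightOneSpectrum (NumberField.RingOfIntegers K) in cofinite, SatakeFrobCompatibleAt ι π.1 ρ v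

/-- childroute.route.json `DensityOneCyclotomicBrightness` verbatim (2028 chars). -/
def DensityOneCyclotomicBrightnessInline : Prop :=
  ∀ (K : Type) [Field K] [NumberField K] (n : ℕ) (S : Finset (IsDedekindDomain.HeightOneSpectrum (NumberField.RingOfIntegers K))) (Q : IsDedekindDomain.HeightOneSpectrum (NumberField.RingOfIntegers K) → Polynomial ℂ) (I : Finset ℤ) (L : Set ℕ) (r : ∀ (ℓ' : ℕ) [Fact ℓ'.Prime], (PadicAlgCl ℓ' ≃+* ℂ) → Literature.NumberTheory.GaloisRepresentations.FramedGaloisRep K (PadicAlgCl ℓ') n), ((∃ E : Subfield ℂ, FiniteDimensional ℚ E ∧ ∀ v : IsDedekindDomain.HeightOneSpectrum (NumberField.RingOfIntegers K), v ∉ S → ∀ i : ℕ, (Q v).coeff i ∈ E) ∧ Literature.NumberTheory.LFunctions.HasDirichletDensity L 1 ∧ ∀ (ℓ' : ℕ) [Fact ℓ'.Prime], ℓ' ∈ L → ∀ ι' : PadicAlgCl ℓ' ≃+* ℂ, (r ℓ' ι').toGaloisRep.IsIrreducible ∧ (∀ᶠ v : IsDedekindDomain.HeightOneSpectrum (NumberField.RingOfIntegers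 K) in cofinite, (r ℓ' ι').IsUnramifiedAt v) ∧ (∀ v : IsDedekindDomain.HeightOneSpectrum (NumberField.RingOfIntegers K), v ∉ S → ((ℓ' : ℕ) : NumberField.RingOfIntegers K) ∉ v.asIdeal → (r ℓ' ι').IsUnramifiedAt v ∧ (r ℓ' ι').HasFrobCharpolyAt v ((Q v).map (ι'.symm : ℂ ≃+* PadicAlgCl ℓ').toRingHom)) ∧ ∀ (v : IsDedekindDomain.HeightOneSpectrum (NumberField.RingOfIntegers K)) (hv : ((ℓ' : ℕ) : NumberField.RingOfIntegers K) ∈ v.asIdeal), (Literature.NumberTheory.PAdicHodge.fontainePstAdicCompletion v ℓ' hv).IsDeRhamFramed ((r ℓ' ι').toLocal v) ∧ (v ∉ S → (Literature.NumberTheory.PAdicHodge.fontainePstAdicCompletion v ℓ' hv).IsCrystallineFramed ((r ℓ' ι').toLocal v) ∧ letI := (Literature.NumberTheory.PAdicHodge.fontainePstAdicCompletion v ℓ' hv).algebra; ∀ τ : v.adicCompletion K →ₐ[ℚ_[ℓ']] PadicAlgCl ℓ', ∀ h ∈ (r ℓ' ι').labelledHodgeTateWeightsAt v (Literature.NumberTheory.PAdicHodge.fontainePstAdicCompletion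 v ℓ' hv).algebra (Literature.NumberTheory.PAdicHodge.fontainePstAdicCompletion v ℓ' hv).𝔅 τ.toRingHom, h ∈ I)) → ∃ L' : Set ℕ, L' ⊆ L ∧ Literature.NumberTheory.LFunctions.HasDirichletDensity L' 1 ∧ ∀ (ℓ' : ℕ) [Fact ℓ'.Prime], ℓ' ∈ L' → ∀ ι' : PadicAlgCl ℓ' ≃+* ℂ, ((r ℓ' ι').restrictField (CyclotomicField ℓ' K)).IsResiduallyAbsIrreducible

/-- childroute.route.json `SolvableAscentConstituent` verbatim (1958 chars). -/
def SolvableAscentConstituentInline : Prop :=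
  (∀ (K : Type) [Field K] [NumberField K] (n : ℕ) (hcpt : Literature.NumberTheory.Automorphic.isCompact_glFiniteIntegralLevel n K), 0 < n → ∀ (π : Literature.NumberTheory.Automorphic.CuspidalAutomorphicRepData n K hcpt), π.1.IsLAlgebraic → ∀ (ℓ : ℕ) [Fact ℓ.Prime] (ι : PadicAlgCl ℓ ≃+* ℂ), ∃ ρ : Literature.NumberTheory.GaloisRepresentations.FramedGaloisRep K (PadicAlgCl ℓ) n, ρ.toGaloisRep.IsIrreducible ∧ ∀ᶠ v : IsDedekindDomain.HeightOneSpectrum (NumberField.RingOfIntegers K) in cofinite, SatakeFrobCompatibleAt ι π.1 ρ v) → ∀ (M : Type) [Field M] [NumberField M] (n : ℕ) (ℓ : ℕ) [Fact ℓ.Prime] (ι : PadicAlgCl ℓ ≃+* ℂ) (ρ : Literature.NumberTheory.GaloisRepresentations.FramedGaloisRep M (PadicAlgCl ℓ) n), ρ.toGaloisRep.IsIrreducible → 0 < n → (∀ hcpt : Literature.NumberTheory.Automorphic.isCompact_glFiniteIntegralLevel n M, ∃ π : Literature.NumberTheory.Automorphic.CuspidalAutomorphicRepData n M hcpt, π.1.IsLAlgebraic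 ∧ ∀ᶠ v : IsDedekindDomain.HeightOneSpectrum (NumberField.RingOfIntegers M) in Filter.cofinite, SatakeFrobCompatibleAt ι π.1 ρ v) → ∀ (N : Type) [Field N] [NumberField N] [Algebra M N], IsGalois M N → IsSolvable (N ≃ₐ[M] N) → ∃ (m : ℕ) (ϑ : Literature.NumberTheory.GaloisRepresentations.FramedGaloisRep N (PadicAlgCl ℓ) m), ϑ.toGaloisRep.IsIrreducible ∧ (∃ (mc : ℕ) (θc : Literature.NumberTheory.GaloisRepresentations.FramedGaloisRep N (PadicAlgCl ℓ) mc), ∀ g : Field.absoluteGaloisGroup N, Literature.NumberTheory.GaloisRepresentations.FramedRep.trace (ρ.restrictField N) g = Literature.NumberTheory.GaloisRepresentations.FramedRep.trace ϑ g + Literature.NumberTheory.GaloisRepresentations.FramedRep.trace θc g) ∧ 0 < m ∧ ∀ hcptN : Literature.NumberTheory.Automorphic.isCompact_glFiniteIntegralLevel m N, ∃ π : Literature.NumberTheory.Automorphic.CuspidalAutomorphicRepData m N hcptN, π.1.IsLAlgebraic ∧ ∀ᶠ v : IsDedekindDomain.HeightOneSpectrum (NumberField.RingOfIntegers N) in Filter.cofinite,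 SatakeFrobCompatibleAt ι π.1 ϑ v

/-- childroute.route.json `CliffordSolvableDescent` verbatim (2319 chars). -/
def CliffordSolvableDescentInline : Prop :=
  (∀ (K : Type) [Field K] [NumberField K] (n : ℕ) (hcpt : Literature.NumberTheory.Automorphic.isCompact_glFiniteIntegralLevel n K), 0 < n → ∀ (π : Literature.NumberTheory.Automorphic.CuspidalAutomorphicRepData n K hcpt), π.1.IsLAlgebraic → ∀ (ℓ : ℕ) [Fact ℓ.Prime] (ι : PadicAlgCl ℓ ≃+* ℂ), ∃ ρ : Literature.NumberTheory.GaloisRepresentations.FramedGaloisRep K (PadicAlgCl ℓ) n, ρ.toGaloisRep.IsIrreducible ∧ ∀ᶠ v : IsDedekindDomain.HeightOneSpectrum (NumberField.RingOfIntegers K) in Filter.cofinite, SatakeFrobCompatibleAt ι π.1 ρ v) → ∀ (K : Type) [Field K] [NumberField K] (n : ℕ) (ℓ : ℕ) [Fact ℓ.Prime] (ι : PadicAlgCl ℓ ≃+* ℂ) (ρ : Literature.NumberTheory.GaloisRepresentations.FramedGaloisRep K (PadicAlgCl ℓ) n), ρ.toGaloisRep.IsIrreducible → ((∀ᶠ v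 : IsDedekindDomain.HeightOneSpectrum (NumberField.RingOfIntegers K) in Filter.cofinite, ρ.IsUnramifiedAt v) ∧ ∀ (v : IsDedekindDomain.HeightOneSpectrum (NumberField.RingOfIntegers K)) (hv : ((ℓ : ℕ) : NumberField.RingOfIntegers K) ∈ v.asIdeal), (Literature.NumberTheory.PAdicHodge.fontainePstAdicCompletion v ℓ hv).IsDeRhamFramed (ρ.toLocal v)) → 0 < n → ∀ (E : Type) [Field E] [NumberField E] [Algebra K E], IsGalois K E → IsSolvable (E ≃ₐ[K] E) → ∀ (m : ℕ) (ϑ : Literature.NumberTheory.GaloisRepresentations.FramedGaloisRep E (PadicAlgCl ℓ) m), ϑ.toGaloisRep.IsIrreducible → (∃ (mc : ℕ) (θc : Literature.NumberTheory.GaloisRepresentations.FramedGaloisRep E (PadicAlgCl ℓ) mc), ∀ g : Field.absoluteGaloisGroup E, Literature.NumberTheory.GaloisRepresentations.FramedRep.trace (ρ.restrictField E) g = Literature.NumberTheory.GaloisRepresentations.FramedRep.trace ϑ g + Literature.NumberTheory.GaloisRepresentations.FramedRep.trace θc g) → 0 < m → (∀ hcptE : Literature.NumberTheory.Automorphic.isCompact_glFiniteIntegralLevel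 m E, ∃ π : Literature.NumberTheory.Automorphic.CuspidalAutomorphicRepData m E hcptE, π.1.IsLAlgebraic ∧ ∀ᶠ v : IsDedekindDomain.HeightOneSpectrum (NumberField.RingOfIntegers E) in Filter.cofinite, SatakeFrobCompatibleAt ι π.1 ϑ v) → ∀ hcpt : Literature.NumberTheory.Automorphic.isCompact_glFiniteIntegralLevel n K, ∃ π : Literature.NumberTheory.Automorphic.CuspidalAutomorphicRepData n K hcpt, π.1.IsLAlgebraic ∧ ∀ᶠ v : IsDedekindDomain.HeightOneSpectrum (NumberField.RingOfIntegers K) in Filter.cofinite, SatakeFrobCompatibleAt ι π.1 ρ v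

/-- The LONE item text (route.json one-liner) is the structured cell `LoneDarkHigherRankLifting` (definitional). -/
theorem lone_inline_iff : LoneDarkHigherRankLiftingInline ↔ LoneDarkHigherRankLifting := Iff.rfl
/-- The BRIGHT item text (route.json one-liner) is the structured cell `DensityOneCyclotomicBrightness` (definitional). -/
theorem bright_inline_iff : DensityOneCyclotomicBrightnessInline ↔ DensityOneCyclotomicBrightness := Iff.rfl
/-- The AUT↑ item text (route.json one-liner) is the structured cell `SolvableAscentConstituent` (definitional). -/
theorem autup_inline_iff : SolvableAscentConstituentInline ↔ SolvableAscentConstituent := Iff.rfl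
/-- The CSD item text is the tree decl `HolomorphicLimitSplit.CliffordSolvableDescent` verbatim (dedup-attach). -/
theorem csd_inline_iff : CliffordSolvableDescentInline ↔ HolomorphicLimitSplit.CliffordSolvableDescent := Iff.rfl
/-- The SOLVM clause inserted into RNO₃ is `SolvablyMated ι ρ` (definitional). -/
theorem solvm_clause_iff (K : Type) [Field K] [NumberField K] (n : ℕ) (ℓ : ℕ) [Fact ℓ.Prime] (ι : PadicAlgCl ℓ ≃+* ℂ) (ρ : FramedGaloisRep K (PadicAlgCl ℓ) n) :
    ((∃ (S : Finset (IsDedekindDomain.HeightOneSpectrum (NumberField.RingOfIntegers K))) (Q : IsDedekindDomain.HeightOneSpectrum (NumberField.RingOfIntegers K) → Polynomial ℂ) (I : Finset ℤ) (L : Set ℕ) (r : ∀ (ℓ' : ℕ) [Fact ℓ'.Prime], (PadicAlgCl ℓ' ≃+* ℂ) → FramedGaloisRep K (PadicAlgCl ℓ') n), ((∃ E : Subfield ℂ, FiniteDimensional ℚ E ∧ ∀ v : IsDedekindDomain.HeightOneSpectrum (NumberField.RingOfIntegers K), v ∉ S → ∀ i : ℕ, (Q v).coeff i ∈ E) ∧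 Literature.NumberTheory.LFunctions.HasDirichletDensity L 1 ∧ ∀ (ℓ' : ℕ) [Fact ℓ'.Prime], ℓ' ∈ L → ∀ ι' : PadicAlgCl ℓ' ≃+* ℂ, (r ℓ' ι').toGaloisRep.IsIrreducible ∧ (∀ᶠ v : IsDedekindDomain.HeightOneSpectrum (NumberField.RingOfIntegers K) in cofinite, (r ℓ' ι').IsUnramifiedAt v) ∧ (∀ v : IsDedekindDomain.HeightOneSpectrum (NumberField.RingOfIntegers K), v ∉ S → ((ℓ' : ℕ) : NumberField.RingOfIntegers K) ∉ v.asIdeal → (r ℓ' ι').IsUnramifiedAt v ∧ (r ℓ' ι').HasFrobCharpolyAt v ((Q v).map (ι'.symm : ℂ ≃+* PadicAlgCl ℓ').toRingHom)) ∧ ∀ (v : IsDedekindDomain.HeightOneSpectrum (NumberField.RingOfIntegers K)) (hv : ((ℓ' : ℕ) : NumberField.RingOfIntegers K) ∈ v.asIdeal), (Literature.NumberTheory.PAdicHodge.fontainePstAdicCompletion v ℓ' hv).IsDeRhamFramed ((r ℓ' ι').toLocal v) ∧ (v ∉ S → (Literature.NumberTheory.PAdicHodge.fontainePstAdicCompletion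 v ℓ' hv).IsCrystallineFramed ((r ℓ' ι').toLocal v) ∧ letI := (Literature.NumberTheory.PAdicHodge.fontainePstAdicCompletion v ℓ' hv).algebra; ∀ τ : v.adicCompletion K →ₐ[ℚ_[ℓ']] PadicAlgCl ℓ', ∀ h ∈ (r ℓ' ι').labelledHodgeTateWeightsAt v (Literature.NumberTheory.PAdicHodge.fontainePstAdicCompletion v ℓ' hv).algebra (Literature.NumberTheory.PAdicHodge.fontainePstAdicCompletion v ℓ' hv).𝔅 τ.toRingHom, h ∈ I)) ∧ ∀ v : IsDedekindDomain.HeightOneSpectrum (NumberField.RingOfIntegers K), v ∉ S → ((ℓ : ℕ) : NumberField.RingOfIntegers K) ∉ v.asIdeal → ρ.IsUnramifiedAt v ∧ ρ.HasFrobCharpolyAt v ((Q v).map (ι.symm : ℂ ≃+* PadicAlgCl ℓ).toRingHom)) ∨ ∃ (N : Type) (_ : Field N) (_ : NumberField N) (_ : Algebra K N) (M : Type) (_ : Field M) (_ : NumberField M) (_ : Algebra K M) (_ : Algebra M N) (_ : IsScalarTower K M N), IsGalois K N ∧ IsSolvable (N ≃ₐ[K] N) ∧ (ρ.restrictField M).toGaloisRep.IsIrreducible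 ∧ ∃ (S : Finset (IsDedekindDomain.HeightOneSpectrum (NumberField.RingOfIntegers M))) (Q : IsDedekindDomain.HeightOneSpectrum (NumberField.RingOfIntegers M) → Polynomial ℂ) (I : Finset ℤ) (L : Set ℕ) (r : ∀ (ℓ' : ℕ) [Fact ℓ'.Prime], (PadicAlgCl ℓ' ≃+* ℂ) → FramedGaloisRep M (PadicAlgCl ℓ') n), ((∃ E : Subfield ℂ, FiniteDimensional ℚ E ∧ ∀ v : IsDedekindDomain.HeightOneSpectrum (NumberField.RingOfIntegers M), v ∉ S → ∀ i : ℕ, (Q v).coeff i ∈ E) ∧ Literature.NumberTheory.LFunctions.HasDirichletDensity L 1 ∧ ∀ (ℓ' : ℕ) [Fact ℓ'.Prime], ℓ' ∈ L → ∀ ι' : PadicAlgCl ℓ' ≃+* ℂ, (r ℓ' ι').toGaloisRep.IsIrreducible ∧ (∀ᶠ v : IsDedekindDomain.HeightOneSpectrum (NumberField.RingOfIntegers M) in cofinite, (r ℓ' ι').IsUnramifiedAt v) ∧ (∀ v : IsDedekindDomain.HeightOneSpectrum (NumberField.RingOfIntegers M), v ∉ S → ((ℓ' : ℕ) : NumberField.RingOfIntegers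 M) ∉ v.asIdeal → (r ℓ' ι').IsUnramifiedAt v ∧ (r ℓ' ι').HasFrobCharpolyAt v ((Q v).map (ι'.symm : ℂ ≃+* PadicAlgCl ℓ').toRingHom)) ∧ ∀ (v : IsDedekindDomain.HeightOneSpectrum (NumberField.RingOfIntegers M)) (hv : ((ℓ' : ℕ) : NumberField.RingOfIntegers M) ∈ v.asIdeal), (Literature.NumberTheory.PAdicHodge.fontainePstAdicCompletion v ℓ' hv).IsDeRhamFramed ((r ℓ' ι').toLocal v) ∧ (v ∉ S → (Literature.NumberTheory.PAdicHodge.fontainePstAdicCompletion v ℓ' hv).IsCrystallineFramed ((r ℓ' ι').toLocal v) ∧ letI := (Literature.NumberTheory.PAdicHodge.fontainePstAdicCompletion v ℓ' hv).algebra; ∀ τ : v.adicCompletion M →ₐ[ℚ_[ℓ']] PadicAlgCl ℓ', ∀ h ∈ (r ℓ' ι').labelledHodgeTateWeightsAt v (Literature.NumberTheory.PAdicHodge.fontainePstAdicCompletion v ℓ' hv).algebra (Literature.NumberTheory.PAdicHodge.fontainePstAdicCompletion v ℓ' hv).𝔅 τ.toRingHom, h ∈ I)) ∧ ∀ v : IsDedekindDomain.HeightOneSpectrum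 (NumberField.RingOfIntegers M), v ∉ S → ((ℓ : ℕ) : NumberField.RingOfIntegers M) ∉ v.asIdeal → (ρ.restrictField M).IsUnramifiedAt v ∧ (ρ.restrictField M).HasFrobCharpolyAt v ((Q v).map (ι.symm : ℂ ≃+* PadicAlgCl ℓ).toRingHom)) ↔ SolvablyMated ι ρ := Iff.rfl
/-- The SOLVRED clause inserted into RNO₃ (v3 carve, critic row 167) is `SolvablyReducible ρ` (definitional). -/
theorem solvred_clause_iff (K : Type) [Field K] [NumberField K] (n : ℕ) (ℓ : ℕ) [Fact ℓ.Prime] (ρ : FramedGaloisRep K (PadicAlgCl ℓ) n) :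
    (∃ (E : Type) (_ : Field E) (_ : NumberField E) (_ : Algebra K E), IsGalois K E ∧ IsSolvable (E ≃ₐ[K] E) ∧ ∃ (m : ℕ) (ϑ : FramedGaloisRep E (PadicAlgCl ℓ) m), m < n ∧ 0 < m ∧ ϑ.toGaloisRep.IsIrreducible ∧ ((∀ᶠ v : IsDedekindDomain.HeightOneSpectrum (NumberField.RingOfIntegers E) in cofinite, ϑ.IsUnramifiedAt v) ∧ ∀ (v : IsDedekindDomain.HeightOneSpectrum (NumberField.RingOfIntegers E)) (hv : ((ℓ : ℕ) : NumberField.RingOfIntegers E) ∈ v.asIdeal), (Literature.NumberTheory.PAdicHodge.fontainePstAdicCompletion v ℓ hv).IsDeRhamFramed (ϑ.toLocal v)) ∧ (∃ (mc : ℕ) (θc : FramedGaloisRep E (PadicAlgCl ℓ) mc), ∀ g : Field.absoluteGaloisGroup E, Literature.NumberTheory.GaloisRepresentations.FramedRep.trace (ρ.restrictField E) g = Literature.NumberTheory.GaloisRepresentations.FramedRep.trace ϑ g + Literature.NumberTheory.GaloisRepresentations.FramedRep.trace θc g)) ↔ SolvablyReducible ρ := Iff.rfl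

/-! ## §8 OFFER — the same bypass for the WHOLE non-A† part of Lift_w (F†, RPO, RNO₂, RNO₃ at once):
Lift_w ⟺ LONE_w modulo {BRIGHT, OW, RES, W⁺, A†}.  Read: in the Serre_w-frame of the host, dark-prime / small-prime lifting is an
independent difficulty ONLY for absolutely lone ρ — the Khare–Wintenberger prime switch, typed. (Informational; not a filing: the rev-8 cells
RPO / RNO₂ / F† keep their print engines and rungs.) -/

/-- LONE_w — Lift_w (with its inductive hypothesis) on the SOLVABLY IRREDUCIBLE, ABSOLUTELY LONE instances of any residual image at any prime. -/
def LoneLifting : Prop :=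
  ∀ (K : Type) [Field K] [NumberField K] (n : ℕ) (hcpt : Literature.NumberTheory.Automorphic.isCompact_glFiniteIntegralLevel n K), 0 < n →
    LiftBelow n → ∀ (ℓ : ℕ) [Fact ℓ.Prime] (ι : PadicAlgCl ℓ ≃+* ℂ) (ρ : FramedGaloisRep K (PadicAlgCl ℓ) n),
      ¬ SolvablyReducible ρ → ¬ SolvablyMated ι ρ → LiftTail K n hcpt ℓ ι ρ

/-- Lift_w ⟹ LONE_w (sub-box, IH unused). -/
theorem loneLifting_of_liftw (h : OdlyzkoWorldSplit.AutomorphyLifting) : LoneLifting :=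
  fun K _ _ n hcpt hn _ ℓ _ ι ρ _ _ => h K n hcpt hn ℓ ι ρ

/-- LONE_w ∧ BRIGHT ⟹ Lift_w modulo {OW, RES, W⁺, A†} (strong induction on the rank; the carve and the family dial per instance). -/
theorem liftw_of_lone (hL : LoneLifting) (hB : DensityOneCyclotomicBrightness)
    (hOW : OdlyzkoWorldSplit.OdlyzkoWorldAutomorphy) (hRES : OdlyzkoWorldSplit.TransOdlyzkoAutomorphy)
    (hW : OdlyzkoWorldSplit.SatakeAvatarExistence) (hA : OdlyzkoWorldSplit.IrreducibleLargePrimeLifting)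
    (hUp : SolvableAscentConstituent) (hCSD : HolomorphicLimitSplit.CliffordSolvableDescent) :
    OdlyzkoWorldSplit.AutomorphyLifting := by
  suffices key : ∀ n, LiftAt n from fun K _ _ n hcpt hn ℓ _ ι ρ => key n K hcpt hn ℓ ι ρ
  intro n
  induction n using Nat.strong_induction_on with
  | _ n ihn =>
    intro K _ _ hcpt hn ℓ _ ι ρ
    have ih : LiftBelow n := fun m hm => ihn m hm
    by_cases hsr : SolvablyReducible ρ
    · intro hirr hgeo _
      exact weakAut_of_solvablyReducible (serre_of_worlds hOW hRES) hW hCSD K n hcpt hn ih ℓ ι ρ hirr hgeo hsr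
    by_cases hsm : SolvablyMated ι ρ
    · intro hirr hgeo _
      exact weakAut_of_solvablyMated hB (serre_of_worlds hOW hRES) hW hA hUp hCSD K n hcpt hn ih ℓ ι ρ hirr hgeo hsm
    · exact hL K n hcpt hn ih ℓ ι ρ hsr hsm

/-- **Lift_w ⟺ LONE_w modulo {BRIGHT, AUT↑, CSD, OW, RES, W⁺, A†}.** -/
theorem liftw_iff_lone (hB : DensityOneCyclotomicBrightness)
    (hOW : OdlyzkoWorldSplit.OdlyzkoWorldAutomorphy) (hRES : OdlyzkoWorldSplit.TransOdlyzkoAutomorphy)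
    (hW : OdlyzkoWorldSplit.SatakeAvatarExistence) (hA : OdlyzkoWorldSplit.IrreducibleLargePrimeLifting)
    (hUp : SolvableAscentConstituent) (hCSD : HolomorphicLimitSplit.CliffordSolvableDescent) :
    OdlyzkoWorldSplit.AutomorphyLifting ↔ LoneLifting :=
  ⟨loneLifting_of_liftw, fun hL => liftw_of_lone hL hB hOW hRES hW hA hUp hCSD⟩

/-- Host-level reading of the OFFER: OW → RES → LONE_w → BRIGHT → W⁺ → A† → AUT↑ → CSD → P → L∤R → CRD → Langlands (eleven binders; F†, RPO, RNO₂, RNO₃ absorbed). -/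
theorem langlands_of_lone_w (hOW : OdlyzkoWorldSplit.OdlyzkoWorldAutomorphy) (hRES : OdlyzkoWorldSplit.TransOdlyzkoAutomorphy)
    (hL : LoneLifting) (hB : DensityOneCyclotomicBrightness) (hW : OdlyzkoWorldSplit.SatakeAvatarExistence)
    (hA : OdlyzkoWorldSplit.IrreducibleLargePrimeLifting) (hUp : SolvableAscentConstituent) (hCSD : HolomorphicLimitSplit.CliffordSolvableDescent)
    (hP : OdlyzkoWorldSplit.PadicMemberCompatibility)
    (hLR : OdlyzkoWorldSplit.CompatibilityAwayFromLR) (hCRD : OdlyzkoWorldSplit.CanonicalReciprocityData) : _root_.Langlands :=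
  OdlyzkoWorldSplit.closes hOW hRES (liftw_of_lone hL hB hOW hRES hW hA hUp hCSD) hW hP hLR hCRD

namespace Cert
/-- S ⟹ LONE_w. -/
theorem loneLifting_of_langlands (hS : _root_.Langlands) : LoneLifting := loneLifting_of_liftw (liftw_of_langlands hS)
end Cert

end Summit.Langlands.Langlands.Theorems.BrightMate
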